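import Literature.NumberTheory.EllipticCurves.ZpExtensionEisensteinTwistLocalH1UniformBoundProofs
import Literature.NumberTheory.EllipticCurves.AnticyclotomicPrimeDecompositionAnyPrimeProofs
import Literature.NumberTheory.EllipticCurves.CastellaGrossiLeeSkinner2022.HeegnerPointKolyvaginSystem
import Literature.NumberTheory.QuadraticFields.HeegnerCondition
import Literature.NumberTheory.GaloisRepresentations.LocalGlobalCohomology
import HarnessLib

/-!
# The (N1) local torsion bound of the pushforward at the places of `S = {v ∣ pN}` prime to `p`: under (Heeg) a place over `N`
# has degree one, so it is finitely decomposed in an anticyclotomic `ℤ_p`-extension (Brink) and `p^{8N_v}` kills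
# `H¹(K_v, E[p^j] ⊗ A_{m,j}(ψ))` for all `j` once `m > 2N_v` (theorems only)

Topic `NumberTheory/EllipticCurves` (sequel of x9-p1-w4's `ZpExtensionEisensteinTwistLocalH1UniformBoundProofs` ((N1), uniform form),
`AnticyclotomicPrimeDecompositionAnyPrimeProofs` (Brink, Thm. 2: a degree-one place `∤ p` is finitely decomposed in `K_∞^anti`),
`QuadraticFields/HeegnerCondition` (`e = f = 1` at totally split primes) and lit's `CastellaGrossiLeeSkinner2022/HeegnerPointKolyvaginSystem`
(`S = placesDividing K (pN)`)).  Cell `pub/bsd-print-x9`, seat `bsd-line-x9-p2` g4: the hypothesis `hS` of THE pushforward `Hom`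
(`ZpExtensionShapiroToEisensteinHom`, the `cond_le` at the bad places away from `p`) and of
`exists_eisensteinKolyvaginSystem_one_eq_proj`, DISCHARGED at the (F-411) set `S = {v ∣ pN}` for `m ≫ 0`.

Howard needs nothing here (his `S_𝔭`-levels); in the `Λ → S_𝔮` specialisation the relaxed source condition at `v ∣ N` must land in
the SATURATED unramified target condition, which is all of `H¹(K_v, T_𝔮/p^k)` as soon as a fixed power of `p` kills these groups
(x9-p1-w4's (N1): `p^{8N_v} · H¹(K_v, E[p^j] ⊗ A_{m,j}(ψ)) = 0` for all `j` and all `m > 2N_v`, provided `v ∤ p` is NOT totally split in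
`K_∞`).  Under (Heeg) every `ℓ ∣ N` splits in the imaginary quadratic `K`, so `v ∣ N` has `e(v) = f(v) = 1` and Brink's Thm. 2
(`decomp_not_le_kerSubgroup_of_isAnticyclotomic_anyPrime`) says `D_v ⊄ Gal(K̄/K_∞)` for anticyclotomic `κ`.
* `ZpExtension.not_decomp_le_kerSubgroup_of_natCast_mem` — `v ∣ N`, `v ∤ p`, (Heeg), `κ` anticyclotomic ⇒ `¬ (D_v ≤ ker κ)` (the
  per-place input `hdv` of the H.4/H.5(b) assemblies at `v ∈ S ∖ {p}` as well);
* **`WeierstrassCurve.exists_forall_mem_placesDividing_pow_smul_galoisCohomology_eq_zero`** — `∃ m₁, ∀ m > m₁, ∀ v ∈ {v ∣ pN}, v ∤ p →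
  ∃ c, ∀ j ≥ 1, p^c · H¹(K_v, E_K[p^j] ⊗ A_{m,j}(ψ)) = 0` (the `hS` of the pushforward, verbatim, at every `m > m₁`).
Theorems only; no named fact, no instance, no notation, no `sorry`.  BSD is not proved by any of this.

References: [Howard2004HeegnerKolyvagin] Lemma 2.2.7, Def. 2.1.1 (saturation); [CastellaGrossiLeeSkinner2022] §1 (Heeg), §3.4 (Σ = {w ∣ pN∞});
[Brink2007] Thm. 2 (pp. 2134–2135) and Cor. 1; [Marcus2018] Ch. 3, Thm. 21 (efg = n).
-/

noncomputable section

open scoped TensorProduct NumberField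
open Field IsDedekindDomain NumberField

/-! ## §1 `e(𝔭|𝓞_ℚ) = e(𝔭|ℤ)`, `f(𝔭|𝓞_ℚ) = f(𝔭|ℤ)` (change of base for Brink's hypotheses) -/

namespace Literature.NumberTheory.EllipticCurves.ZpExtension

open Literature.NumberTheory.GaloisRepresentations Literature.NumberTheory.GaloisCohomology

variable {K : Type} [Field K] [NumberField K]

-- adapted from Summits/BirchSwinnertonDyer/BirchSwinnertonDyer/Theorems/PrintCf2SplitBadEisensteinTwoFinLocOfOrdinaryFiltration.lean
/-- `e(𝔭|𝓞 ℚ) = e(𝔭|ℤ)` (the base `𝓞 ℚ` of Brink's statement vs Mathlib's `ℤ`). [cite: Marcus2018, Ch. 3, Thm. 21] -/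
private theorem ramificationIdx_rat_eq_int (q : Ideal (𝓞 K)) : q.ramificationIdx (𝓞 ℚ) = q.ramificationIdx ℤ := by
  by_cases hq : q.IsPrime
  · rw [Ideal.ramificationIdx_def, Ideal.ramificationIdx_def]
    have hsurj : Function.Surjective (algebraMap ℤ (𝓞 ℚ)) := Rat.int_algebraMap_surjective (𝓞 ℚ)
    have hφ : algebraMap ℤ (Localization.AtPrime q) =
        (algebraMap (𝓞 ℚ) (Localization.AtPrime q)).comp (algebraMap ℤ (𝓞 ℚ)) := RingHom.ext_int _ _
    have hunder : q.under ℤ = (q.under (𝓞 ℚ)).comap (algebraMap ℤ (𝓞 ℚ)) := by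
      rw [Ideal.under_def, Ideal.under_def, Ideal.comap_comap, ← RingHom.ext_int
        (algebraMap ℤ (𝓞 K)) ((algebraMap (𝓞 ℚ) (𝓞 K)).comp (algebraMap ℤ (𝓞 ℚ)))]
    have hI : (q.under ℤ).map (algebraMap ℤ (Localization.AtPrime q)) =
        (q.under (𝓞 ℚ)).map (algebraMap (𝓞 ℚ) (Localization.AtPrime q)) := by
      rw [hunder, hφ, ← Ideal.map_map, Ideal.map_comap_of_surjective _ hsurj]
    rw [hI]
  · rw [Ideal.ramificationIdx_of_not_isPrime q _ hq, Ideal.ramificationIdx_of_not_isPrime q _ hq]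

-- adapted from Summits/BirchSwinnertonDyer/BirchSwinnertonDyer/Theorems/PrintCf2SplitBadEisensteinTwoFinLocOfOrdinaryFiltration.lean
/-- `f(𝔭|𝓞 ℚ) = f(𝔭|ℤ)`. [cite: Marcus2018, Ch. 3, Thm. 21] -/
private theorem inertiaDeg_rat_eq_int (q : Ideal (𝓞 K)) [q.IsMaximal] : q.inertiaDeg (𝓞 ℚ) = q.inertiaDeg ℤ := by
  haveI hQ : (q.under (𝓞 ℚ)).IsMaximal := Ideal.IsMaximal.under (𝓞 ℚ) q
  have h1 : (q.under (𝓞 ℚ)).inertiaDeg ℤ = 1 := by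
    set Q := q.under (𝓞 ℚ)
    haveI : (Q.under ℤ).IsMaximal := Ideal.IsMaximal.under ℤ Q
    rw [← Ideal.inertiaDeg'_eq_inertiaDeg (Q.under ℤ) Q, Ideal.inertiaDeg'_algebraMap]
    letI : Field (ℤ ⧸ Q.under ℤ) := Ideal.Quotient.field _
    letI : Field (𝓞 ℚ ⧸ Q) := Ideal.Quotient.field _
    have hsurj : Function.Surjective (algebraMap (ℤ ⧸ Q.under ℤ) (𝓞 ℚ ⧸ Q)) := by
      intro y
      obtain ⟨y, rfl⟩ := Ideal.Quotient.mk_surjective y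
      obtain ⟨x, rfl⟩ := Rat.int_algebraMap_surjective (𝓞 ℚ) y
      exact ⟨Ideal.Quotient.mk _ x, rfl⟩
    have e : (ℤ ⧸ Q.under ℤ) ≃ₗ[ℤ ⧸ Q.under ℤ] (𝓞 ℚ ⧸ Q) :=
      LinearEquiv.ofBijective (Algebra.linearMap (ℤ ⧸ Q.under ℤ) (𝓞 ℚ ⧸ Q))
        ⟨(algebraMap (ℤ ⧸ Q.under ℤ) (𝓞 ℚ ⧸ Q)).injective, hsurj⟩
    rw [← e.finrank_eq, Module.finrank_self]
  rw [Ideal.inertiaDeg_tower (R := ℤ) (q.under (𝓞 ℚ)) q, h1, one_mul]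

/-! ## §2 Under (Heeg), a place over `N` prime to `p` is finitely decomposed in an anticyclotomic `ℤ_p`-extension -/

variable {p : ℕ} [hp : Fact p.Prime] (κ : ZpExtension K p)

/-- **`D_v ⊄ Gal(K̄/K_∞)` at `v ∣ N`, `v ∤ p`, under (Heeg)** (`K` imaginary quadratic, `κ` anticyclotomic): the residue characteristic
`ℓ` of `v` divides `N`, so `ℓ` splits in `K` ((Heeg)), `e(v) = f(v) = 1`, and Brink's Thm. 2 applies.  This is the `hdec` input of
x9-p1-w4's (N1) bound and of the H.4 / H.5(b) clauses at the places of `S ∖ {p}`.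
[cite: Brink2007, Thm. 2 (pp. 2134–2135) and Cor. 1] [cite: CastellaGrossiLeeSkinner2022, §1 (Heeg)] [cite: Marcus2018, Ch. 3, Thm. 21] -/
theorem not_decomp_le_kerSubgroup_of_natCast_mem (hK : IsImaginaryQuadratic K) (hκ : κ.IsAnticyclotomic) {N : ℕ}
    (hHeeg : SatisfiesHeegnerHypothesis N K) {v : HeightOneSpectrum (𝓞 K)} (hNv : ((N : ℕ) : 𝓞 K) ∈ v.asIdeal)
    (hpv : ((p : ℕ) : 𝓞 K) ∉ v.asIdeal) : ¬ (GreenbergSelmer.decomp v ≤ κ.kerSubgroup) := by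
  haveI : Finite (𝓞 K ⧸ v.asIdeal) := v.asIdeal.finiteQuotientOfFreeOfNeBot v.ne_bot
  letI : Field (𝓞 K ⧸ v.asIdeal) := Ideal.Quotient.field _
  set ℓ := Howard2004.residueChar v with hℓdef
  have hℓ : ℓ.Prime := by
    rw [hℓdef]; unfold Howard2004.residueChar; exact CharP.char_is_prime (𝓞 K ⧸ v.asIdeal) _
  have hℓN : ℓ ∣ N := by
    refine (ringChar.spec (𝓞 K ⧸ v.asIdeal) N).mp ?_
    rw [← map_natCast (Ideal.Quotient.mk v.asIdeal), Ideal.Quotient.eq_zero_iff_mem]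
    exact hNv
  have hℓv : ((ℓ : ℕ) : 𝓞 K) ∈ v.asIdeal := by
    rw [← Ideal.Quotient.eq_zero_iff_mem, map_natCast]
    exact (ringChar.spec (𝓞 K ⧸ v.asIdeal) _).mpr dvd_rfl
  have hℓ0 : Ideal.span {(ℓ : ℤ)} ≠ ⊥ := by
    rw [ne_eq, Ideal.span_singleton_eq_bot]; exact_mod_cast hℓ.ne_zero
  haveI hmax : (Ideal.span {(ℓ : ℤ)}).IsMaximal :=
    ((Ideal.span_singleton_prime (by exact_mod_cast hℓ.ne_zero)).mpr (Nat.prime_iff_prime_int.mp hℓ)).isMaximal hℓ0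
  have hunder : v.asIdeal.under ℤ = Ideal.span {(ℓ : ℤ)} := by
    refine (hmax.eq_of_le (Ideal.comap_ne_top _ v.isPrime.ne_top) ?_).symm
    rw [Ideal.span_singleton_le_iff_mem, Ideal.mem_comap, eq_intCast, Int.cast_natCast]
    exact hℓv
  haveI : v.asIdeal.LiesOver (Ideal.span {(ℓ : ℤ)}) := ⟨hunder.symm⟩
  haveI : v.asIdeal.IsMaximal := v.isPrime.isMaximal v.ne_bot
  have hP : v.asIdeal ∈ (Ideal.span {(ℓ : ℤ)}).primesOver (𝓞 K) := ⟨v.isPrime, inferInstance⟩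
  obtain ⟨he, hf⟩ := QuadraticFields.SplitPrime.ramificationIdx_eq_one_of_ncard_primesOver hℓ
    ((hHeeg ℓ hℓ hℓN).trans hK.1.symm) hP
  rw [Ideal.ramificationIdx'_eq_ramificationIdx (Ideal.span {(ℓ : ℤ)}) v.asIdeal hℓ0] at he
  rw [Ideal.inertiaDeg'_eq_inertiaDeg (Ideal.span {(ℓ : ℤ)}) v.asIdeal] at hf
  exact decomp_not_le_kerSubgroup_of_isAnticyclotomic_anyPrime K p hK κ hκ v hpv
    (by rw [ramificationIdx_rat_eq_int]; exact he) (by rw [inertiaDeg_rat_eq_int]; exact hf)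

end Literature.NumberTheory.EllipticCurves.ZpExtension

/-! ## §3 The (N1) bound at the places of `{v ∣ pN}` prime to `p`, for `m ≫ 0` -/

namespace WeierstrassCurve

open Literature.NumberTheory.EllipticCurves Literature.NumberTheory.GaloisRepresentations
open Literature.NumberTheory.EllipticCurves.ZpExtension
open Literature.NumberTheory.EllipticCurves.CastellaGrossiLeeSkinner2022

variable {K : Type} [Field K] [NumberField K] (W : WeierstrassCurve K) [W.IsElliptic] {p : ℕ} [hp : Fact p.Prime]
  (κ : ZpExtension K p)

/-- **The (N1) local torsion bound at the bad places of `S = {v ∣ pN}` away from `p`, for `m ≫ 0`** (`K` imaginary quadratic,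
(Heeg), `κ` anticyclotomic): there is `m₁` such that for every `m > m₁` (`m ≥ 1`), every `v ∣ pN` with `v ∤ p` and every `j ≥ 1`, a
power of `p` (namely `p^{8N_v}`, x9-p1-w4's (N1)) kills `H¹(K_v, E[p^j] ⊗ A_{m,j}(ψ))` — the hypothesis `hS` of the pushforward
`Hom` / of `exists_eisensteinKolyvaginSystem_one_eq_proj` at `S := placesDividing K (pN)`, verbatim (maximum of the `2N_v` over the
finitely many `v ∈ S`). [cite: Howard2004HeegnerKolyvagin, Lemma 2.2.7 and Def. 2.1.1] [cite: CastellaGrossiLeeSkinner2022, §1 (Heeg) and §3.4] [cite: Brink2007, Thm. 2] -/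
theorem exists_forall_mem_placesDividing_pow_smul_galoisCohomology_eq_zero (hK : IsImaginaryQuadratic K)
    (hκ : κ.IsAnticyclotomic) {N : ℕ} (hHeeg : SatisfiesHeegnerHypothesis N K) (hpN : p * N ≠ 0) :
    ∃ m₁ : ℕ, ∀ (m : ℕ) (hm : 1 ≤ m), m₁ < m →
      ∀ v ∈ placesDividing K (p * N) hpN, ((p : ℕ) : 𝓞 K) ∉ v.asIdeal → ∃ c : ℕ, ∀ j, 1 ≤ j →
        ∀ x : galoisCohomology ((κ.eisensteinTwist (W.torsionGaloisModule ((p : ℤ) ^ j)) hm j).toLocal (Sum.inr v)) 1,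
          p ^ c • x = 0 := by
  classical
  -- the per-place bound `2 N_v` (and `0` at the places above `p`, where nothing is claimed)
  have hv : ∀ v ∈ placesDividing K (p * N) hpN, ((p : ℕ) : 𝓞 K) ∉ v.asIdeal →
      ∃ Nv : ℕ, 1 ≤ Nv ∧ ∀ (m : ℕ) (hm : 1 ≤ m), 2 * Nv < m → ∀ (j : ℕ)
        (x : galoisCohomology (GaloisRep.toLocal v
          (κ.eisensteinTwist (W.torsionGaloisModule ((p : ℤ) ^ j)) hm j)) 1), p ^ (8 * Nv) • x = 0 := by
    intro v hvS hpv
    have hNv : ((N : ℕ) : 𝓞 K) ∈ v.asIdeal :=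
      (natCast_mem_or_natCast_mem_of_mem_placesDividing hpN hvS).resolve_left hpv
    exact exists_forall_pow_smul_galoisCohomology_one_toLocal_eq_zero_uniform v W κ hpv
      (κ.not_decomp_le_kerSubgroup_of_natCast_mem hK hκ hHeeg hNv hpv)
  choose! Nv hNv using hv
  refine ⟨(placesDividing K (p * N) hpN).sup (fun v ↦ 2 * Nv v), fun m hm hm₁ v hvS hpv ↦ ⟨8 * Nv v, fun j _ x ↦ ?_⟩⟩
  have h2 : 2 * Nv v < m := lt_of_le_of_lt (Finset.le_sup (f := fun v ↦ 2 * Nv v) hvS) hm₁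
  exact (hNv v hvS hpv).2 m hm h2 j x

end WeierstrassCurve

end
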